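import Summits.BirchSwinnertonDyer.BirchSwinnertonDyer.Theorems.ByReductionTypeAtTwoSupersingularColemanRoadV5
import HarnessLib

/-!
# Route `ByReductionTypeAtTwo` (rung K4), crux `SupersingularRankZeroAtTwo` (item
# stmt-BirchSwinnertonDyer-19097): Kobayashi's Thm. 1.2 AT `2` (`X⁺(E/ℚ_∞)` finitely generated and
# TORSION) is NOT an independent input on the Coleman road v5 — it follows, at the cyclotomic-variable
# generators, from the v5 package + the two Kato facts + rank `0` (seat `bsd-2adic-ss-1`, GEN 8)

HONEST FRAMING (cell `bsd-2adic`, run/shared/lean/pub/bsd-2adic/, HUMAN RULINGS D-0036/D-0054/D-0074):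
THEOREMS ONLY; every research input an explicit hypothesis; no definition, no named fact, no instance,
no `sorry`; nothing booked; BSD is NOT proved by any of this. PARTITION (D-0054): X5@2 good-supersingular,
`a₂ = 0` sub-row (B1·O1; 208 rank-`0` classes) × `p = 2` — types-the-object-of (the binder `h12` of the
class doors `SSColemanRoad.bsdp_two_of_colemanKatoV5_of_pow_dvd` / `…_baseChange_int_…` and of the 208
class files of GEN 8); closes none.

## What is proved

The class doors display `h12 : ∀ κ γ (cyclotomic, top generator) (D : dual datum of Sel⁺(E/ℚ_∞)),
X⁺ finitely generated ∧ Λ-torsion` (Kobayashi, Invent. 152, Thm. 1.2 READ AT 2). Finite generation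
is the tree theorem `Kobayashi2003.SignedSelmerDualData.moduleFinite` (any `p`). TORSION at `2` is
Kobayashi's Thm. 7.3 ii), which in print FOLLOWS from (7.21) + Thm. 6.3 + Rohrlich; on the Coleman road
it is `SSColemanRoad.signedSelmerDual_isTorsion_of_colemanSkeleton` (GEN 7, p482717: pure module theory,
`Kato2004.thm17_4_skeleton`) once the pinned `G = 2^m·ϖ·L♭` is NON-ZERO — and in analytic rank `0`
it is: `L♭(0) = (−a₂² + 2a₂ + 1)·[0]⁺_f = [0]⁺_f ≠ 0` (`constantCoeff_flat_two_of_isSprungPair_of_isNewformOf`,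
`L(E,1) = [0]⁺_f·Ω⁺_f ≠ 0`) and `ϖ > 0`. Hence `finite_and_isTorsion_signedSelmerDual_two_of_colemanKatoV5`:
PRINT {modularity `hmod`, `Kato2004.thm12_4`, `Kato2004_fineSelmerDual_isTorsion`} + the v5 package at
`W` + {good at `2`, `a₂ = 0`, `L(E,1) ≠ 0`} ⇒ `h12` for every cyclotomic `κ` and every top generator `γ`
MATCHING THE CYCLOTOMIC VARIABLE (`IsCyclotomicVariable 2 γ` — the generators the package quantifies
over). The residual content of the displayed `h12` is therefore only the transport of Λ-torsion between
top generators of `Γ` (not in the tree: a `SignedSelmerDualData` carries its `Λ`-structure through `γ`).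
References: [Kobayashi2003] Thm. 1.2, Thm. 6.3, Thm. 7.3 (pp. 2, 11, 13); [Kato2004Asterisque] Thm. 12.4,
§17.13; [Sprung2017] Cor. 4.4 (the `♭` constant at `2`); [Rohrlich1984] (non-vanishing, replaced here by
rank `0`).
-/

set_option autoImplicit false
-- the Theorems namespace of this sub repeats the summit name by design (D-0017 nested layout)
set_option linter.dupNamespace false

noncomputable section

open scoped Classical MatrixGroups ModularForm
open CongruenceSubgroup WeierstrassCurve Literature.NumberTheory.EllipticCurves
  Literature.NumberTheory.EllipticCurves.ModularForms Literature.NumberTheory.EllipticCurves.Sprung2017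
  Literature.NumberTheory.EllipticCurves.Rank1Residual Literature.NumberTheory.EllipticCurves.Rank1Residual.Typed
  Literature.NumberTheory.EllipticCurves.Kobayashi2003 Literature.NumberTheory.EllipticCurves.IwasawaDual
  ZpExtension Summit.BirchSwinnertonDyer.Rank1Residual Summit.BirchSwinnertonDyer.Rank1Residual.Supersingular
  Summit.BirchSwinnertonDyer.Rank1Residual.X5.O1

namespace Summit.BirchSwinnertonDyer.BirchSwinnertonDyer.Theorems
namespace SSColemanRoad

variable (W : WeierstrassCurve ℚ) [W.IsElliptic] [W.IsGloballyMinimal]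

/-- **Kobayashi Thm. 1.2 at `2` (`X⁺(E/ℚ_∞)` finitely generated and `Λ`-torsion) FROM the v5 Coleman–Kato
package at `W`, the two Kato facts and rank `0`**, for every cyclotomic `ℤ₂`-extension `κ` and every
topological generator `γ` matching the cyclotomic variable: finite generation by the tree theorem
`SignedSelmerDualData.moduleFinite`; torsion by `signedSelmerDual_isTorsion_of_colemanSkeleton`
(Kobayashi Thm. 7.3 ii) as module theory) applied to the package's skeleton at the modular newform `f`,
the period ratio `ϖ > 0` and Sprung's/Pollack's pair at `2`, where `G = 2^m·ϖ·L♭ ≠ 0` because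
`L♭(0) = [0]⁺_f ≠ 0` in analytic rank `0` (`a₂ = 0`: `c♭ = 1`). So the doors' binder `h12` restricted to
cyclotomic-variable generators is a CONSEQUENCE of `hCK` + PRINT + `L(E,1) ≠ 0`.
[cite: Kobayashi2003, Thm. 1.2 (p. 2) and Thm. 7.3 (p. 13)] [cite: Kato2004Asterisque, Thm. 12.4 (1)(2) (p. 221)]
[cite: Sprung2017, Cor. 4.4] -/
theorem finite_and_isTorsion_signedSelmerDual_two_of_colemanKatoV5
    (hmod : nonempty_modularParametrizationData)
    (h124 : Kato2004.thm12_4) (hX0 : Kato2004_fineSelmerDual_isTorsion)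
    (hgood : W.HasGoodReductionAtPrime 2) (ha : W.frobeniusTrace 2 = 0)
    (hL : W.entireLFunction 1 ≠ 0)
    (hCK : ∀ (κ : ZpExtension ℚ 2) (γ : Field.absoluteGaloisGroup ℚ),
      κ.IsCyclotomic → κ.IsTopGenerator γ → IsCyclotomicVariable 2 γ →
      ∀ [NeZero (W.conductorNorm ℤ)] (f : CuspForm (Gamma0 (W.conductorNorm ℤ)) 2),
        IsNewformOf W f → ∀ (ϖ : ℚ), (ϖ : ℝ) * W.realPeriodRat = plusPeriod f →
      ∀ (Lplus Lminus : IwasawaAlgebra 2), IsPollackPair f 2 Lplus Lminus →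
      ∀ (D : SignedSelmerDualData W κ γ 1) [ContinuousSMul ℤ_[2] (W.tateModule 2)],
        ∃ (I : Kato2004.IwasawaH1Data W 2 κ γ) (Y : W.FineSelmerDualData κ γ)
          (P : Submodule (IwasawaAlgebra 2) (IwasawaAlgebra 2))
          (loc : I.H →ₗ[IwasawaAlgebra 2] P) (toX : P →ₗ[IwasawaAlgebra 2] D.X)
          (δ : D.X →ₗ[IwasawaAlgebra 2] Y.X) (Z : Submodule (IwasawaAlgebra 2) I.H)
          (G : IwasawaAlgebra 2) (m : ℕ),
          Function.Exact loc toX ∧ Function.Exact toX δ ∧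
          G ∈ Submodule.map (P.subtype ∘ₗ loc) Z ∧
          iwasawaToPowerSeries 2 G =
            PowerSeries.C ((2 : ℚ_[2]) ^ m * (ϖ : ℚ_[2])) *
              iwasawaToPowerSeries 2 (kobayashiL 1 Lplus Lminus) ∧
          (∀ 𝔭 : PrimeSpectrum (IwasawaAlgebra 2), 𝔭.asIdeal.height = 1 →
            PowerSeries.C (2 : ℤ_[2]) ∉ 𝔭.asIdeal →
            Literature.NumberTheory.EllipticCurves.Module.lengthAt (IwasawaAlgebra 2) Y.X 𝔭 ≤
              Literature.NumberTheory.EllipticCurves.Module.lengthAt (IwasawaAlgebra 2) (I.H ⧸ Z) 𝔭) ∧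
          (TwoAdicSurjective W → m = 0 ∧
            ∀ 𝔭 : PrimeSpectrum (IwasawaAlgebra 2), 𝔭.asIdeal.height = 1 →
              PowerSeries.C (2 : ℤ_[2]) ∈ 𝔭.asIdeal →
              Literature.NumberTheory.EllipticCurves.Module.lengthAt (IwasawaAlgebra 2) Y.X 𝔭 ≤
                Literature.NumberTheory.EllipticCurves.Module.lengthAt (IwasawaAlgebra 2) (I.H ⧸ Z) 𝔭)) :
    ∀ (κ : ZpExtension ℚ 2) (γ : Field.absoluteGaloisGroup ℚ),
      κ.IsCyclotomic → κ.IsTopGenerator γ → IsCyclotomicVariable 2 γ →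
      ∀ D : SignedSelmerDualData W κ γ 1,
        Module.Finite (IwasawaAlgebra 2) D.X ∧ Module.IsTorsion (IwasawaAlgebra 2) D.X := by
  intro κ γ hκ hγ hγ' D
  refine ⟨D.moduleFinite hγ, ?_⟩
  -- modularity: the newform `f` of `E` and the period ratio `ϖ > 0`
  haveI : NeZero (W.conductorNorm ℤ) := ⟨(W.conductorNorm_pos_holds).ne'⟩
  obtain ⟨Dm⟩ := hmod W
  set f := Dm.f with hf_def
  have hf : IsNewformOf W f := Dm.isNewformOf
  obtain ⟨ϖ, hϖpos, hϖeq, hΩpos⟩ := Dm.exists_rat_mul_realPeriodRat_eq_plusPeriod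
  -- `[0]⁺_f ≠ 0` in analytic rank `0`
  set s : ℚ := ratPlusSymbol f 0 with hs_def
  have hLval : W.entireLFunction 1 = (((s : ℝ) * plusPeriod f : ℝ) : ℂ) := hf.entireLFunction_one_eq
  have hs0 : s ≠ 0 := by
    intro h0
    apply hL
    rw [hLval, h0]
    simp
  -- Sprung's pair at `2` (a Pollack pair since `a₂ = 0`) and its `♭` constant `L♭(0) = s`
  obtain ⟨Ls, Lf, hSP, hPP⟩ := exists_isPollackPair_two hf hgood ha hL
  have hLf0 := constantCoeff_flat_two_of_isSprungPair_of_isNewformOf hf hgood hSP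
  rw [ha] at hLf0
  -- the package at this datum
  haveI : ContinuousSMul ℤ_[2] (W.tateModule 2) := TateModule.continuousSMul_padicInt
  obtain ⟨I, Y, P, loc, toX, δ, Z, G, m, hPX, hXY, hGZ, hιG, -, -⟩ :=
    hCK κ γ hκ hγ hγ' f hf ϖ hϖeq Ls Lf hPP D
  have hkL : kobayashiL (1 : ℤˣ) Ls Lf = Lf := by unfold kobayashiL; rw [if_pos rfl]
  rw [hkL] at hιG
  -- `G ≠ 0`: its constant term is `2^m · ϖ · s ≠ 0`
  have hG : G ≠ 0 := by
    intro hG0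
    have hc := congrArg PowerSeries.constantCoeff hιG
    rw [hG0, map_zero, map_zero, map_mul, PowerSeries.constantCoeff_C,
      constantCoeff_iwasawaToPowerSeries, hLf0] at hc
    have hne : ((2 : ℚ_[2]) ^ m * (ϖ : ℚ_[2])) *
        (((-(0 : ℤ) : ℚ) ^ 2 + 2 * ((0 : ℤ) : ℚ) + 1) * s : ℚ) ≠ 0 := by
      refine mul_ne_zero (mul_ne_zero (pow_ne_zero _ two_ne_zero) ?_) ?_
      · exact_mod_cast hϖpos.ne'
      · push_cast; ring_nf; exact_mod_cast hs0
    exact hne hc.symm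
  -- torsion from the skeleton (Kobayashi Thm. 7.3 ii) as module theory)
  have hY : Module.IsTorsion (IwasawaAlgebra 2) Y.X := hX0 W 2 κ γ hκ hγ Y
  obtain ⟨htf, hrank⟩ := h124.isTorsionFree_and_rank_le_one W 2 hκ hγ I
  haveI := htf
  exact signedSelmerDual_isTorsion_of_colemanSkeleton I hrank Y D loc P.subtype P.injective_subtype
    toX δ hPX hXY hY Z hG hGZ

end SSColemanRoad
end Summit.BirchSwinnertonDyer.BirchSwinnertonDyer.Theorems

end
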